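import Literature.Computability.AlgebraicComplexity.DIP20PlethysmValuesRow4
import HarnessLib

/-!
# Dörfler–Ikenmeyer–Panova 2019, Prop. 3.15, rows 3 and 4, UNCONDITIONALLY

Topic `Literature/Computability/AlgebraicComplexity`; continuation of `DIP20PlethysmValues.lean` (rows 1–2,
`DIP20_prop_3_15_row1/row2`) with the values of `DIP20PlethysmValuesRow3.lean` / `…Row4.lean`. No new
facts, no new definitions. J. Dörfler, C. Ikenmeyer, G. Panova, SIAM J. Appl. Algebra Geom. 4 (2020) =
arXiv:1901.04576, Prop. 3.15 (arXiv pp. 7–8; TeX `multobs.tex` L513 `{pro:occobsdoexist}`): "The following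
partitions give occurrence obstructions that show `Pow_{m,d}^n ⊄ Ch_m^n`": row 3 `(m,n,λ,d) =
(3,4,(11,9,8),7)`, row 4 `(3,5,(12,9,9),6)`, i.e. `mult_λ(ℂ[Ch_m^n]_d) = 0 < mult_λ(ℂ[Pow_{m,d}^n]_d)` —
Chow side by Lemma 3.4 (`DIP20_lem_3_4_holds`) with `a_λ(n[d]) = 0`, power-sum side by Prop. 3.3 with
`a_λ(d[n]) = 1`, exactly as for rows 1–2. With these, four of the five conjuncts of the named fact
`DIP20_prop_3_15` are theorems; row 5 (`(14,14,13,13)`, four letters) is `DIP20_prop_3_15_of_row5`.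

HONEST FRAMING: toy model `Pow ⊄ Ch`; nothing here bears on permanent versus determinant; VP ≠ VNP is
not proved.

## References

* J. Dörfler, C. Ikenmeyer, G. Panova, SIAM J. Appl. Algebra Geom. 4 (2020) = arXiv:1901.04576,
  Prop. 3.15 (arXiv pp. 7–8). [DorflerIkenmeyerPanova2020]
-/

namespace Literature.Computability.AlgebraicComplexity

open _root_.Literature.NumberTheory.DiophantineGeometry

/-- **Prop. 3.15, row 3, unconditionally**: `(11,9,8)` is an occurrence obstruction showing
`Pow_{3,7}^4 ⊄ Ch_3^4`: `mult_{(11,9,8)}(ℂ[Ch_3^4]_7) = 0 < mult_{(11,9,8)}(ℂ[Pow_{3,7}^4]_7)` (Chow side: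
Lemma 3.4 and `a_{(11,9,8)}(4[7]) = 0`; power-sum side: Prop. 3.3 and `a_{(11,9,8)}(7[4]) = 1`).
[cite: DorflerIkenmeyerPanova2020, Prop. 3.15 (row 3, arXiv pp. 7–8; TeX multobs.tex L513 {pro:occobsdoexist})] -/
theorem DIP20_prop_3_15_row3 :
    coordRingMultiplicity ℂ (chowSet ℂ 3 4) 4 (rowDual ![11, 9, 8]) = 0 ∧
      0 < coordRingMultiplicity ℂ (powerSumSet ℂ 3 7 4) 4 (rowDual ![11, 9, 8]) := by
  refine ⟨?_, ?_⟩
  · refine coordRingMultiplicity_chowSet_eq_zero_of_lem_3_4 DIP20_lem_3_4_holds (by norm_num) (by norm_num)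
      [11, 9, 8] ?_ ?_ (by simp) (by simp) _ ?_ plethysmCoeff_rowDual_11_9_8_seven
    · intro x hx; simp at hx; omega
    · simp
    · intro i; fin_cases i <;> rfl
  · rw [coordRingMultiplicity_powerSumSet_eq_plethysmCoeff (d := 7) (by norm_num) le_rfl
      (by rw [size_rowDual]; simp [Fin.sum_univ_succ]), plethysmCoeff_rowDual_11_9_8_four]
    exact Nat.one_pos

/-- **Prop. 3.15, row 4, unconditionally**: `(12,9,9)` is an occurrence obstruction showing
`Pow_{3,6}^5 ⊄ Ch_3^5`: `mult_{(12,9,9)}(ℂ[Ch_3^5]_6) = 0 < mult_{(12,9,9)}(ℂ[Pow_{3,6}^5]_6)` (Chow side: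
Lemma 3.4 and `a_{(12,9,9)}(5[6]) = 0`; power-sum side: Prop. 3.3 and `a_{(12,9,9)}(6[5]) = 1`).
[cite: DorflerIkenmeyerPanova2020, Prop. 3.15 (row 4, arXiv pp. 7–8; TeX multobs.tex L513 {pro:occobsdoexist})] -/
theorem DIP20_prop_3_15_row4 :
    coordRingMultiplicity ℂ (chowSet ℂ 3 5) 5 (rowDual ![12, 9, 9]) = 0 ∧
      0 < coordRingMultiplicity ℂ (powerSumSet ℂ 3 6 5) 5 (rowDual ![12, 9, 9]) := by
  refine ⟨?_, ?_⟩
  · refine coordRingMultiplicity_chowSet_eq_zero_of_lem_3_4 DIP20_lem_3_4_holds (by norm_num) (by norm_num)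
      [12, 9, 9] ?_ ?_ (by simp) (by simp) _ ?_ plethysmCoeff_rowDual_12_9_9_six
    · intro x hx; simp at hx; omega
    · simp
    · intro i; fin_cases i <;> rfl
  · rw [coordRingMultiplicity_powerSumSet_eq_plethysmCoeff (d := 6) (by norm_num) le_rfl
      (by rw [size_rowDual]; simp [Fin.sum_univ_succ]), plethysmCoeff_rowDual_12_9_9_five]
    exact Nat.one_pos

/-- **Prop. 3.15, rows 1–4 together** (the four three-letter rows of the printed list, all unconditional).
[cite: DorflerIkenmeyerPanova2020, Prop. 3.15 (rows 1–4, arXiv pp. 7–8; TeX multobs.tex L513 {pro:occobsdoexist})] -/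
theorem DIP20_prop_3_15_rows_one_to_four :
    (coordRingMultiplicity ℂ (chowSet ℂ 3 2) 2 (rowDual ![2, 2, 2]) = 0 ∧
      0 < coordRingMultiplicity ℂ (powerSumSet ℂ 3 3 2) 2 (rowDual ![2, 2, 2])) ∧
    (coordRingMultiplicity ℂ (chowSet ℂ 3 3) 3 (rowDual ![7, 3, 2]) = 0 ∧
      0 < coordRingMultiplicity ℂ (powerSumSet ℂ 3 4 3) 3 (rowDual ![7, 3, 2])) ∧
    (coordRingMultiplicity ℂ (chowSet ℂ 3 4) 4 (rowDual ![11, 9, 8]) = 0 ∧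
      0 < coordRingMultiplicity ℂ (powerSumSet ℂ 3 7 4) 4 (rowDual ![11, 9, 8])) ∧
    (coordRingMultiplicity ℂ (chowSet ℂ 3 5) 5 (rowDual ![12, 9, 9]) = 0 ∧
      0 < coordRingMultiplicity ℂ (powerSumSet ℂ 3 6 5) 5 (rowDual ![12, 9, 9])) :=
  ⟨DIP20_prop_3_15_row1, DIP20_prop_3_15_row2, DIP20_prop_3_15_row3, DIP20_prop_3_15_row4⟩

end Literature.Computability.AlgebraicComplexity
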